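import Summits.Ventures.PercRepro.RankLevelSetHallLevelIndep

/-! # RankLevelSetBiIndepProfile — THE BI-INDEPENDENT PROFILE, ITS SYMMETRY, AND THE GLOBAL LEVEL-WISE FORM AT EVERY
LEVEL FROM ITS ULTRA-LOG-CONCAVITY (night-1 g23, attempt 2; dossier §35.10, note proofs/NIGHT-1-BIINDEP-ULC.md)

For a finite matroid `M` on `E` (`#E = n`) the BI-INDEPENDENT PROFILE is `D_r = #{S ⊆ E : #S = r, S independent,
E ∖ S independent}`. It is symmetric (`D_r = D_{n−r}`, by `S ↦ E ∖ S`), and at the tight layer `#E = p + q` of a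
rank-`p` matroid: `D_q = #cellMembers M p q` (a `q`-set is a member iff it and its complement are independent) and,
for `q < t < p`, `D_t = #{independent rank-`t` UP-neighbours of ALL members}` (an independent `t`-set contains a member
iff its complement is independent: extend the complement to a basis `B`; `E ∖ B` is a member inside `S`).

THE NAMED FACT `BiIndepULC M` (a `Prop`, the hypothesis of the theorems below; NOT proved here): `r ↦ D_r/C(n,r)` is
log-concave with no internal zeros. Paper proof (§35.10): the homogenized independence polynomial
`Σ_{S indep} z^S w^{n−#S}` is Lorentzian [Anari–Liu–Oveis Gharan–Vinzant, Log-concave polynomials III, 2018;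
Brändén–Huh, Lorentzian polynomials, Ann. of Math. 192 (2020)]; the product of two copies in the same set variables
with homogenisers `w, w′`, hit by `Π_e ∂_{v_e}` and evaluated at `v = 0`, keeps exactly the pairs `(S, E ∖ S)` and is the
bivariate Lorentzian polynomial `Σ_r D_r w^{n−r} w′^r`; bivariate Lorentzian = ULC coefficients. Mathlib has no
Lorentzian polynomials, so the fact stays a hypothesis; everything else is proved:
  · `lc_symm_ge`: a positive log-concave sequence whose end values satisfy `d q ≤ d p` is `≥ d q` on `[q, p]`;
  · `biIndepCount_compl`: the symmetry `D_{n−r} = D_r`;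
  · `cellMembers_eq_biIndep`, `indepLevelNbhd_members_eq_biIndep`: the two identifications at the tight layer;
  · `levelHallUp_members_of_biIndepULC`: `C(p+q,t)·#𝒵 ≤ C(p+q,q)·#indepLevelNbhd 𝒵` for every `q < t < p`;
  · `levelHallUp_members_rank_of_biIndepULC`: the same with the rank-`t` UP-neighbours (the `𝒜 = 𝒵` case of
    `LevelHallUpC025` at the tight layer); `hallUp_members_of_biIndepULC`: summed over the levels, the `𝒜 = 𝒵` case of
    `HallUpC025` at the tight layer (`phiK p q · #𝒵 ≤ #upNbhd 𝒵`).
All CONDITIONAL on `BiIndepULC M`. Twin numerics of the fact: every matroid on ≤ 9 elements (385,355), random GF(p)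
matroids on ≤ 12 elements, the model family — 0 failures (mining/night-1/g23/biindep.py, kit j299066). Every
declaration has a docstring; imports: the cell's own modules and Mathlib only. -/

namespace PercRepro

open Set Matroid Finset

/-! ## The sequence lemma -/

section Sequence

variable (d : ℕ → ℚ) (q p : ℕ)

/-- **One step**: for a positive log-concave sequence, a decrease `d r < d (r−1)` forces `d (r+1) < d r`. -/
lemma lc_step (hpos : ∀ r, q ≤ r → r ≤ p → 0 < d r)
    (hlc : ∀ r, q + 1 ≤ r → r + 1 ≤ p → d (r - 1) * d (r + 1) ≤ d r ^ 2)
    (r : ℕ) (hr : q + 1 ≤ r) (hr' : r + 1 ≤ p) (h : d r < d (r - 1)) : d (r + 1) < d r := by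
  have h1 := hlc r hr hr'
  have hr0 : 0 < d r := hpos r (by omega) (by omega)
  have hr1 : 0 < d (r - 1) := hpos (r - 1) (by omega) (by omega)
  have h3 : d (r - 1) * d (r + 1) < d (r - 1) * d r := by nlinarith
  exact lt_of_mul_lt_mul_left h3 hr1.le

/-- **After a decrease the sequence keeps decreasing**: `d i < d (i − 1)` for every `r ≤ i ≤ p`. -/
lemma lc_decr_all (hpos : ∀ r, q ≤ r → r ≤ p → 0 < d r)
    (hlc : ∀ r, q + 1 ≤ r → r + 1 ≤ p → d (r - 1) * d (r + 1) ≤ d r ^ 2)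
    (r : ℕ) (hr : q + 1 ≤ r) (h : d r < d (r - 1)) :
    ∀ i, r ≤ i → i ≤ p → d i < d (i - 1) := by
  intro i hi
  induction i, hi using Nat.le_induction with
  | base => intro _; exact h
  | succ i hri ih =>
    intro hip
    have hstep := lc_step d q p hpos hlc i (by omega) hip (ih (by omega))
    simpa using hstep

/-- **Antitone after a decrease**: `d j ≤ d i` for `r ≤ i ≤ j ≤ p`. -/
lemma lc_antitone_from (hpos : ∀ r, q ≤ r → r ≤ p → 0 < d r)
    (hlc : ∀ r, q + 1 ≤ r → r + 1 ≤ p → d (r - 1) * d (r + 1) ≤ d r ^ 2)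
    (r : ℕ) (hr : q + 1 ≤ r) (h : d r < d (r - 1)) :
    ∀ i j, r ≤ i → i ≤ j → j ≤ p → d j ≤ d i := by
  intro i j hri hij
  induction j, hij using Nat.le_induction with
  | base => intro _; exact le_rfl
  | succ j hij' ih =>
    intro hjp
    have hdec := lc_decr_all d q p hpos hlc r hr h (j + 1) (by omega) hjp
    simp only [Nat.add_sub_cancel] at hdec
    exact le_trans hdec.le (ih (by omega))

/-- **A first decrease exists** below a value smaller than the start: if `d t < d q` with `q ≤ t` then some
`r ∈ [q+1, t]` has `d r < d (r − 1)`. -/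
lemma lc_first_decrease : ∀ t, q ≤ t → d t < d q → ∃ r, q + 1 ≤ r ∧ r ≤ t ∧ d r < d (r - 1) := by
  intro t hqt
  induction t, hqt using Nat.le_induction with
  | base => intro h; exact absurd h (lt_irrefl _)
  | succ t hqt' ih =>
    intro h
    by_cases hlt : d (t + 1) < d t
    · exact ⟨t + 1, by omega, le_rfl, by simpa using hlt⟩
    · have hlt' : d t ≤ d (t + 1) := not_lt.mp hlt
      obtain ⟨r, hr1, hr2, hr3⟩ := ih (lt_of_le_of_lt hlt' h)
      exact ⟨r, hr1, by omega, hr3⟩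

/-- **THE SEQUENCE LEMMA**: a positive log-concave sequence on `[q, p]` with `d q ≤ d p` satisfies `d q ≤ d t` for
every `q ≤ t ≤ p` (log-concave ⇒ unimodal ⇒ at least the smaller end value in between). -/
lemma lc_symm_ge (hpos : ∀ r, q ≤ r → r ≤ p → 0 < d r)
    (hlc : ∀ r, q + 1 ≤ r → r + 1 ≤ p → d (r - 1) * d (r + 1) ≤ d r ^ 2)
    (hend : d q ≤ d p) (t : ℕ) (hqt : q ≤ t) (htp : t ≤ p) : d q ≤ d t := by
  by_contra hcon
  have hcon' : d t < d q := not_le.mp hcon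
  obtain ⟨r, hr1, hr2, hr3⟩ := lc_first_decrease d q t hqt hcon'
  have hpt : d p ≤ d t := lc_antitone_from d q p hpos hlc r hr1 hr3 t p hr2 htp le_rfl
  linarith

end Sequence

/-! ## The bi-independent profile -/

variable {α : Type} (M : Matroid α) [M.Finite]

/-- **The bi-independent `r`-sets**: `S ⊆ E` with `#S = r`, `S` independent and `E ∖ S` independent. -/
def biIndep (r : ℕ) : Set (Set α) :=
  {S : Set α | S ⊆ M.E ∧ S.ncard = r ∧ M.Indep S ∧ M.Indep (M.E \ S)}

/-- The bi-independent `r`-sets are finitely many. -/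
lemma biIndep_finite (r : ℕ) : (biIndep M r).Finite :=
  M.ground_finite.finite_subsets.subset (fun _ h => h.1)

/-- **The bi-independent profile** `D_r = #biIndep r`. -/
noncomputable def biIndepCount (r : ℕ) : ℕ := (biIndep M r).ncard

/-- **The normalised profile** `d_r = D_r / C(#E, r)`. -/
noncomputable def biIndepNorm (r : ℕ) : ℚ := (biIndepCount M r : ℚ) / ((M.E.ncard).choose r : ℚ)

omit [M.Finite] in
/-- **THE NAMED FACT (ULC of the bi-independent profile)** — a `Prop`, the hypothesis of the theorems below, NOT proved
in the tree: `r ↦ D_r/C(n,r)` is log-concave, and the profile has no internal zeros. Source of the paper proof (the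
references are quoted from memory, the literature tool being down in this sparse root): Anari, Liu, Oveis Gharan,
Vinzant, «Log-concave polynomials III: Mason's ultra-log-concavity conjecture for independent sets of matroids»
(2018), and Brändén, Huh, «Lorentzian polynomials», Ann. of Math. 192 (2020) — the homogenized independence polynomial
is Lorentzian; Lorentzian polynomials are closed under products, derivatives and nonnegative linear substitutions;
bivariate Lorentzian = ULC coefficients; see dossier §35.10 for the three-line derivation. -/
def BiIndepULC : Prop :=
  (∀ r, 1 ≤ r → r + 1 ≤ M.E.ncard →
      biIndepNorm M (r - 1) * biIndepNorm M (r + 1) ≤ biIndepNorm M r ^ 2) ∧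
  (∀ a b c, a ≤ b → b ≤ c → 0 < biIndepCount M a → 0 < biIndepCount M c → 0 < biIndepCount M b)

/-- The complement of a bi-independent `r`-set is a bi-independent `(#E − r)`-set. -/
lemma mem_biIndep_compl {r : ℕ} {S : Set α} (hS : S ∈ biIndep M r) : M.E \ S ∈ biIndep M (M.E.ncard - r) := by
  obtain ⟨hSE, hcard, hind, hind'⟩ := hS
  refine ⟨Set.sdiff_subset, ?_, hind', ?_⟩
  · rw [Set.ncard_sdiff' hSE M.ground_finite, hcard]
  · rw [Set.sdiff_sdiff_cancel_left hSE]; exact hind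

/-- **THE SYMMETRY OF THE PROFILE**: `D_{#E − r} = D_r` for `r ≤ #E`. -/
lemma biIndepCount_compl (r : ℕ) (hr : r ≤ M.E.ncard) :
    biIndepCount M (M.E.ncard - r) = biIndepCount M r := by
  unfold biIndepCount
  refine Set.ncard_congr (fun S _ => M.E \ S) ?_ ?_ ?_
  · intro S hS
    have := mem_biIndep_compl M hS
    rwa [Nat.sub_sub_self hr] at this
  · intro S T hS hT hST
    have h1 : M.E \ (M.E \ S) = M.E \ (M.E \ T) := by rw [hST]
    rwa [Set.sdiff_sdiff_cancel_left hS.1, Set.sdiff_sdiff_cancel_left hT.1] at h1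
  · intro T hT
    exact ⟨M.E \ T, mem_biIndep_compl M hT, Set.sdiff_sdiff_cancel_left hT.1⟩

/-- **The members of the cell `(p, q)` at the tight layer are the bi-independent `q`-sets**: with `#E = p + q`, a set
`Z` has `r(Z) = q` and `r(E ∖ Z) = p` iff `#Z = q`, `Z` is independent and `E ∖ Z` is independent. -/
lemma cellMembers_eq_biIndep {p q : ℕ} (hE : M.E.ncard = p + q) : cellMembers M p q = biIndep M q := by
  ext Z
  constructor
  · rintro ⟨hZE, hrZ, hrZ'⟩
    have hZfin : Z.Finite := M.ground_finite.subset hZE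
    have hZ'fin : (M.E \ Z).Finite := M.ground_finite.subset Set.sdiff_subset
    have h1 : (q : ℕ∞) ≤ (Z.ncard : ℕ∞) := by
      rw [hZfin.cast_ncard_eq, ← hrZ]; exact M.eRk_le_encard Z
    have h2 : (p : ℕ∞) ≤ ((M.E \ Z).ncard : ℕ∞) := by
      rw [hZ'fin.cast_ncard_eq, ← hrZ']; exact M.eRk_le_encard _
    have h1' : q ≤ Z.ncard := by exact_mod_cast h1
    have h2' : p ≤ (M.E \ Z).ncard := by exact_mod_cast h2
    have hdiff : (M.E \ Z).ncard = M.E.ncard - Z.ncard := Set.ncard_sdiff' hZE M.ground_finite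
    have hZle : Z.ncard ≤ M.E.ncard := Set.ncard_le_ncard hZE M.ground_finite
    have hZq : Z.ncard = q := by omega
    have hZ'p : (M.E \ Z).ncard = p := by omega
    refine ⟨hZE, hZq, ?_, ?_⟩
    · rw [indep_iff_eRk_eq_encard_of_finite hZfin, hrZ, ← hZfin.cast_ncard_eq, hZq]
    · rw [indep_iff_eRk_eq_encard_of_finite hZ'fin, hrZ', ← hZ'fin.cast_ncard_eq, hZ'p]
  · rintro ⟨hZE, hZq, hind, hind'⟩
    have hZfin : Z.Finite := M.ground_finite.subset hZE
    have hZ'fin : (M.E \ Z).Finite := M.ground_finite.subset Set.sdiff_subset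
    have hdiff : (M.E \ Z).ncard = M.E.ncard - Z.ncard := Set.ncard_sdiff' hZE M.ground_finite
    have hZle : Z.ncard ≤ M.E.ncard := Set.ncard_le_ncard hZE M.ground_finite
    have hZ'p : (M.E \ Z).ncard = p := by omega
    refine ⟨hZE, ?_, ?_⟩
    · rw [hind.eRk_eq_encard, ← hZfin.cast_ncard_eq, hZq]
    · rw [hind'.eRk_eq_encard, ← hZ'fin.cast_ncard_eq, hZ'p]

/-- **The independent rank-`t` UP-neighbours of ALL members are the bi-independent `t`-sets** (tight layer, rank `p`,
`q < t < p`): an independent `t`-set contains a member iff its complement is independent. -/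
lemma indepLevelNbhd_members_eq_biIndep {p q t : ℕ} (hE : M.E.ncard = p + q) (hrk : M.eRank = (p : ℕ∞))
    (hqt : q < t) (htp : t < p) :
    indepLevelNbhd M p q t (cellMembers M p q) = biIndep M t := by
  ext S
  constructor
  · rintro ⟨⟨hSE, -, -, Z, hZ, hZS⟩, hind, hcard⟩
    rw [cellMembers_eq_biIndep M hE] at hZ
    refine ⟨hSE, hcard, hind, ?_⟩
    exact hZ.2.2.2.subset (Set.sdiff_subset_sdiff_right hZS)
  · rintro ⟨hSE, hcard, hind, hind'⟩
    have hSfin : S.Finite := M.ground_finite.subset hSE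
    obtain ⟨B, hB, hB'⟩ := hind'.exists_isBase_superset
    have hBE : B ⊆ M.E := hB.subset_ground
    have hBfin : B.Finite := M.ground_finite.subset hBE
    have hBp : B.ncard = p := by
      have h := hB.encard_eq_eRank
      rw [hrk, ← hBfin.cast_ncard_eq] at h
      exact_mod_cast h
    have hZS : M.E \ B ⊆ S := by
      intro x hx
      by_contra hxS
      exact hx.2 (hB' ⟨hx.1, hxS⟩)
    have hZmem : M.E \ B ∈ cellMembers M p q := by
      rw [cellMembers_eq_biIndep M hE]
      refine ⟨Set.sdiff_subset, ?_, hind.subset hZS, ?_⟩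
      · rw [Set.ncard_sdiff' hBE M.ground_finite, hBp]; omega
      · rw [Set.sdiff_sdiff_cancel_left hBE]; exact hB.indep
    have hrS : M.eRk S = (t : ℕ∞) := by
      rw [hind.eRk_eq_encard, ← hSfin.cast_ncard_eq, hcard]
    refine ⟨⟨hSE, ?_, ?_, M.E \ B, hZmem, hZS⟩, hind, hcard⟩
    · rw [hrS]; exact_mod_cast hqt
    · rw [hrS]; exact_mod_cast htp

/-- **THE GLOBAL LEVEL-WISE FORM AT EVERY LEVEL, FROM THE ULC OF THE PROFILE** (tight layer `#E = p + q`, rank `p`,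
`q < t < p`): `C(p+q,t)·#𝒵 ≤ C(p+q,q)·#{S ∈ upNbhd 𝒵 : S independent, #S = t}` — CONDITIONAL on `BiIndepULC M`. -/
theorem levelHallUp_members_of_biIndepULC (hULC : BiIndepULC M) {p q t : ℕ} (hE : M.E.ncard = p + q)
    (hrk : M.eRank = (p : ℕ∞)) (hqp : q ≤ p) (hqt : q < t) (htp : t < p) :
    ((p + q).choose t : ℚ) * ((cellMembers M p q).ncard : ℚ) ≤
      ((p + q).choose q : ℚ) * ((indepLevelNbhd M p q t (cellMembers M p q)).ncard : ℚ) := by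
  rw [indepLevelNbhd_members_eq_biIndep M hE hrk hqt htp, cellMembers_eq_biIndep M hE]
  change ((p + q).choose t : ℚ) * (biIndepCount M q : ℚ) ≤ ((p + q).choose q : ℚ) * (biIndepCount M t : ℚ)
  obtain ⟨hlc, hnz⟩ := hULC
  have hsym : biIndepCount M p = biIndepCount M q := by
    have := biIndepCount_compl M q (by omega)
    rwa [hE, show p + q - q = p by omega] at this
  by_cases hq0 : biIndepCount M q = 0
  · rw [hq0]; simp only [Nat.cast_zero, mul_zero]; positivity
  have hqpos : 0 < biIndepCount M q := Nat.pos_of_ne_zero hq0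
  have hppos : 0 < biIndepCount M p := by rwa [hsym]
  have hpos : ∀ r, q ≤ r → r ≤ p → 0 < biIndepNorm M r := by
    intro r hqr hrp
    unfold biIndepNorm
    have hD : 0 < biIndepCount M r := hnz q r p hqr hrp hqpos hppos
    have hC : 0 < ((M.E.ncard).choose r : ℚ) := by
      exact_mod_cast Nat.choose_pos (by omega)
    exact div_pos (by exact_mod_cast hD) hC
  have hlc' : ∀ r, q + 1 ≤ r → r + 1 ≤ p →
      biIndepNorm M (r - 1) * biIndepNorm M (r + 1) ≤ biIndepNorm M r ^ 2 :=
    fun r hr hr' => hlc r (by omega) (by omega)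
  have hend : biIndepNorm M q ≤ biIndepNorm M p := by
    unfold biIndepNorm
    rw [hsym, hE, Nat.choose_symm_add]
  have hmain := lc_symm_ge (biIndepNorm M) q p hpos hlc' hend t hqt.le htp.le
  unfold biIndepNorm at hmain
  rw [hE] at hmain
  have hCq : 0 < ((p + q).choose q : ℚ) := by exact_mod_cast Nat.choose_pos (by omega)
  have hCt : 0 < ((p + q).choose t : ℚ) := by exact_mod_cast Nat.choose_pos (by omega)
  rw [div_le_div_iff₀ hCq hCt] at hmain
  linarith

/-- **The same with the rank-`t` UP-neighbours** — the `𝒜 = 𝒵` case of `LevelHallUpC025` at the tight layer of a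
rank-`p` matroid, CONDITIONAL on `BiIndepULC M`. -/
theorem levelHallUp_members_rank_of_biIndepULC (hULC : BiIndepULC M) {p q t : ℕ} (hE : M.E.ncard = p + q)
    (hrk : M.eRank = (p : ℕ∞)) (hqp : q ≤ p) (hqt : q < t) (htp : t < p) :
    ((p + q).choose t : ℚ) * ((cellMembers M p q).ncard : ℚ) ≤
      ((p + q).choose q : ℚ) *
        ({S ∈ upNbhd M p q (cellMembers M p q) | M.eRk S = (t : ℕ∞)}.ncard : ℚ) :=
  levelHallUp_of_indepLevel p q t (cellMembers M p q)
    (levelHallUp_members_of_biIndepULC M hULC hE hrk hqp hqt htp)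

/-- **The `𝒜 = 𝒵` case of C-044 UP at the tight layer** (`phiK p q · #𝒵 ≤ #upNbhd 𝒵`), CONDITIONAL on
`BiIndepULC M`: the level inequalities summed over `q < t < p`, as in `hallUp_of_levelHallUp`. -/
theorem hallUp_members_of_biIndepULC (hULC : BiIndepULC M) {p q : ℕ} (hE : M.E.ncard = p + q)
    (hrk : M.eRank = (p : ℕ∞)) (hqp : q ≤ p) :
    phiK p q * ((cellMembers M p q).ncard : ℚ) ≤ ((upNbhd M p q (cellMembers M p q)).ncard : ℚ) := by
  classical
  have hsplit := ncard_eq_sum_ncard_level (M := M) p q (upNbhd M p q (cellMembers M p q))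
    (upNbhd_subset_cellY (M := M) (cellMembers M p q) p q)
  have hchoose : (0 : ℚ) < ((p + q).choose p : ℚ) := by
    exact_mod_cast Nat.choose_pos (by omega)
  have hsym : ((p + q).choose q : ℚ) = ((p + q).choose p : ℚ) := by
    exact_mod_cast (Nat.choose_symm_add (a := p) (b := q)).symm
  rw [hsplit]
  unfold phiK
  rw [div_mul_eq_mul_div, div_le_iff₀ hchoose, Finset.sum_mul, Finset.sum_mul]
  refine Finset.sum_le_sum (fun t ht => ?_)
  rw [Finset.mem_Ioo] at ht
  have := levelHallUp_members_rank_of_biIndepULC M hULC hE hrk hqp ht.1 ht.2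
  rw [hsym] at this
  linarith

end PercRepro
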